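import Literature.NumberTheory.Automorphic.QuaternionIdealLocallyPrincipal
import Literature.NumberTheory.Automorphic.BrandtModuleWeightSymm
import HarnessLib

/-!
# Sub-ideals of index `n²` contain `n` times the ideal; proof of the named fact
# `brandtMatrix_weight_symm` (Eichler 1973, II §6 Thm. 2 (17))

Sibling proof file of `Literature/NumberTheory/Automorphic/BrandtModule.lean` (next to
`BrandtModuleProofs.lean` and `BrandtModuleEichlerPackageProofs.lean`), discharging its named fact

> `brandtMatrix_weight_symm : ∀ N⁺ N⁻ (P : EichlerPackage N⁺ N⁻) n i j,
>     w_j · B(n)_ij = w_i · B(n)_ji`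

— the self-adjointness of the Brandt matrices for the height pairing `⟨e_i, e_j⟩ = w_i δ_ij`
(Eichler, LNM 320, II §6 Thm. 2 eq. (17) with `l = 0`: `B(n)ᵀ = diag(e)⁻¹ B(n) diag(e)`,
`e_i = |O_iˣ| = 2 w_i`; Gross 1987 §1 (1.8); Pizer 1980 Prop. 2.20; Pollack–Weston 2011 §2.1
"intersection pairing under which `𝕋` is adjoint").

## The printed proof and the proof given here

Eichler's proof ((21)–(22) loc. cit.) passes from an integral ideal `M ⊆ J` of reduced norm
`n · nrd J` to its *conjugate*: the bijection `α ↦ n α⁻¹` between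
`A_ij(n) = {α : α I_i ⊆ I_j, [I_j : α I_i] = n²}` and `A_ji(n)` (together with
`2 w_i B(n)_ij = #A_ij(n)`) gives (17). That `n α⁻¹ I_j ⊆ I_i`, i.e. **`n J ⊆ M` for every
sub-ideal `M ⊆ J` of index `n²` between invertible right `O`-ideals**, is the only arithmetic
input; it is read off locally, where ideals of Eichler orders are principal. The tree already
contains the reduction of the named fact to exactly this input
(`brandtMatrix_weight_symm_of_forall_nsmul_le`, `BrandtModuleWeightSymm.lean`, on top of the
bijection `Brandt.nonempty_equiv_of_nsmul_le` of `BrandtWeightSymmetry.lean`) and, since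
`QuaternionIdealLocallyPrincipal.lean`, Kaplansky's theorem (Voight, *Quaternion Algebras*,
Main Thm. 16.6.1): invertible right ideals of a `ℤ`-order in a division quaternion algebra over
`ℚ` are locally principal. This file supplies the input and assembles:

1. `IsInvertibleRightIdeal.natCast_smul_mem_localAt` — the local statement at a prime `p`:
   with `J_(p) = β O_(p)` and `M_(p) = β δ O_(p)`, `δ ∈ O` (Kaplansky, after clearing a
   denominator prime to `p`), the local index is `[J_(p) : M_(p)] = [O_(p) : δ O_(p)] =
   p^{v_p [O : δ O]} = p^{2 v_p(nrd δ)}` (`relIndex_localAt` of `LatticeLocalGlobal.lean` and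
   `[O : δ O] = nrd(δ)²`, `Brandt.cast_relIndex_units_smul_eq_reducedNorm_sq`), while
   `[J_(p) : M_(p)] = p^{v_p(n²)}`; so `v_p(nrd δ) = v_p(n)`, `n / nrd δ ∈ ℤ_(p)`, and for
   `y = β z ∈ J_(p)`: `n y = β δ · (n / nrd δ) δ̄ z ∈ β δ O_(p) = M_(p)` because `δ̄ ∈ O`
   (`δ⁻¹ = δ̄ / nrd δ`, Vignéras I §1; `Brandt.IsOrder.standardInvolution_mem`).
2. `IsInvertibleRightIdeal.natCast_smul_mem_of_relIndex_eq_sq` — **`n J ⊆ M`** globally, by the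
   local–global principle for membership (`mem_of_forall_prime_mem_localAt`, Voight 9.4.6).
3. `brandtMatrix_weight_symm_holds` — the named fact, for every Eichler package; and the same
   symmetry in the vocabulary of `BrandtXi.lean` (the one in which Pollack–Weston's
   `ξ_f(N⁺, N⁻)` is vendored): `Brandt.weight_mul_matrix_symm` for every `ℤ`-order in a totally
   definite quaternion algebra over `ℚ`, `Brandt.XiSetup.weight_mul_matrix_symm` for every Brandt
   setup, and the adjointness `⟨t_n v, v'⟩ = ⟨v, t_n v'⟩` (`EichlerPackage.pairing_hecke_comm`).

## References

* M. Eichler, *The basis problem for modular forms and the traces of the Hecke operators*,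
  LNM 320 (1973), Ch. II §6 Thm. 2 eq. (17), (21)–(22) [Eichler1973].
* J. Voight, *Quaternion Algebras*, GTM 288 (2021), Lemma 9.4.6, Main Thm. 16.6.1 [Voight2021].
* M.-F. Vignéras, *Arithmétique des algèbres de quaternions*, LNM 800 (1980), Ch. I §1, §4
  Lemme 4.12 [VignerasLNM800].
* R. Pollack, T. Weston, *On anticyclotomic μ-invariants of modular forms*, Compos. Math. 147
  (2011), §2.1 [PollackWeston2011].
-/

noncomputable section

open scoped Pointwise

universe u

namespace Literature.NumberTheory.Automorphic

/-! ### Local step: `n J_(p) ⊆ M_(p)` -/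

section Local

variable {B : Type u} [Ring B] [Algebra ℚ B]

/-- **`L_(p)` is stable under the central units `m · 1`, `m` prime to `p`**:
`(m · 1) L_(p) = L_(p)` (`L_(p)` is a `ℤ_(p)`-module). [folklore] -/
theorem units_smul_localAt_of_val_eq {p m : ℕ} (hm0 : m ≠ 0) (hm : m.Coprime p)
    (L : Submodule ℤ B) {u : Bˣ} (hu : (u : B) = algebraMap ℚ B m) :
    u • localAt p L = localAt p L := by
  ext x
  rw [mem_units_smul_iff_mul_mem]
  have hinv : ((u⁻¹ : Bˣ) : B) = algebraMap ℚ B ((m : ℚ)⁻¹) := by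
    refine Units.inv_eq_of_mul_eq_one_right ?_
    rw [hu, ← map_mul, mul_inv_cancel₀ (by exact_mod_cast hm0 : (m : ℚ) ≠ 0), map_one]
  rw [hinv, ← Algebra.smul_def]
  constructor
  · intro h
    have h' := (localAt p L).smul_mem (m : ℤ) h
    rwa [natCast_zsmul_inv_smul hm0] at h'
  · exact inv_smul_mem_localAt hm0 hm

omit [Algebra ℚ B] in
/-- A translate `δ O` with `δ ∈ O` lies inside the order `O`. [folklore] -/
theorem units_smul_le_of_mem {O : Submodule ℤ B} (hO : IsZOrder O) {δ : Bˣ} (hδ : (δ : B) ∈ O) :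
    δ • O ≤ O := by
  intro x hx
  obtain ⟨y, hy, rfl⟩ := (Submodule.mem_smul_pointwise_iff_exists x δ O).mp hx
  exact hO.mul_mem _ hδ _ hy

variable [IsQuaternionAlgebra ℚ B]

/-- **`[O : δ O] = |nrd δ|²`** as natural numbers, for `δ ∈ O` a unit of `B` with
`nrd δ = N ∈ ℤ`. [cite: VignerasLNM800, Ch. I §1 (N = n²)] -/
theorem relIndex_units_smul_eq_natAbs_sq {O : Submodule ℤ B} (hO : IsZOrder O) {δ : Bˣ}
    (hδ : (δ : B) ∈ O) {N : ℤ} (hN : reducedNorm ℚ B (δ : B) = N) :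
    (δ • O).toAddSubgroup.relIndex O.toAddSubgroup = N.natAbs ^ 2 := by
  have hδL : (δ : B) ∈ Brandt.leftOrder O := fun m hm => hO.mul_mem _ hδ _ hm
  have h := Brandt.cast_relIndex_units_smul_eq_reducedNorm_sq hO.isFullLattice hδL
  rw [hN] at h
  have h' : (((δ • O).toAddSubgroup.relIndex O.toAddSubgroup : ℕ) : ℚ) = ((N.natAbs ^ 2 : ℕ) : ℚ) := by
    rw [h, Nat.cast_pow, Nat.cast_natAbs, Int.cast_abs, sq_abs]
  exact_mod_cast h'

/-- The inverse of a unit `δ` of a quaternion algebra is `nrd(δ)⁻¹ δ̄`. [cite: VignerasLNM800, Ch. I §1 Lemme 1.1] -/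
theorem units_val_inv_eq_smul_standardInvolution (δ : Bˣ) :
    ((δ⁻¹ : Bˣ) : B) = (reducedNorm ℚ B (δ : B))⁻¹ • standardInvolution ℚ B (δ : B) :=
  Units.inv_eq_of_mul_eq_one_right (mul_inv_smul_standardInvolution ℚ
    ((isUnit_iff_reducedNorm_ne_zero_holds ℚ B (δ : B)).mp δ.isUnit))

/-- **The local step of Eichler's conjugate-ideal argument.** Let `O` be a `ℤ`-order in a
quaternion algebra over `ℚ`, `p` a prime, and `M ⊆ J` lattices with `[J : M] = n²`, `n ≠ 0`,
which are principal at `p` in the compatible form `J_(p) = β O_(p)`, `M_(p) = β δ O_(p)` with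
`δ ∈ O`. Then `n J ⊆ M_(p)`: comparing `[J_(p) : M_(p)] = p^{v_p(n²)}` with
`[O_(p) : δ O_(p)] = p^{2 v_p(nrd δ)}` gives `v_p(nrd δ) = v_p(n)`, and
`n β z = β δ · (n / nrd δ) δ̄ z` with `δ̄ ∈ O`, `n / nrd δ ∈ ℤ_(p)`. [cite: Eichler1973, Ch. II §6 Thm. 2, (21)–(22)] -/
theorem natCast_smul_mem_localAt_of_localAt_eq {p : ℕ} [hp : Fact p.Prime]
    {O M J : Submodule ℤ B} (hO : IsZOrder O) {β δ : Bˣ} (hδ : (δ : B) ∈ O)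
    (hJ : localAt p J = β • localAt p O) (hM : localAt p M = (β * δ) • localAt p O)
    (hle : M ≤ J) {n : ℕ} (hn : n ≠ 0) (hidx : M.toAddSubgroup.relIndex J.toAddSubgroup = n ^ 2)
    {y : B} (hy : y ∈ J) : (n : ℤ) • y ∈ localAt p M := by
  -- the reduced norm `N ∈ ℤ` of `δ`, non-zero
  obtain ⟨N, hN⟩ := hO.exists_int_reducedNorm hδ
  have hnrd0 : reducedNorm ℚ B (δ : B) ≠ 0 :=
    (isUnit_iff_reducedNorm_ne_zero_holds ℚ B (δ : B)).mp δ.isUnit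
  have hN0 : (N : ℚ) ≠ 0 := hN ▸ hnrd0
  -- `[O : δ O] = |N|²`, hence `[O_(p) : δ O_(p)] = p ^ v_p(|N|²)`
  have hkO := relIndex_units_smul_eq_natAbs_sq hO hδ hN
  have hkO0 : (δ • O).toAddSubgroup.relIndex O.toAddSubgroup ≠ 0 := by
    rw [hkO]; exact pow_ne_zero 2 (Int.natAbs_ne_zero.mpr (by exact_mod_cast hN0))
  have hlocO := relIndex_localAt (p := p) O (δ • O) (units_smul_le_of_mem hO hδ) hkO0
  -- `[J_(p) : M_(p)] = p ^ v_p(n²)`, and it is also `[O_(p) : δ O_(p)]`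
  have hidx0 : M.toAddSubgroup.relIndex J.toAddSubgroup ≠ 0 := by rw [hidx]; exact pow_ne_zero 2 hn
  have hlocJ := relIndex_localAt (p := p) J M hle hidx0
  rw [hJ, hM, mul_smul, relIndex_units_smul, ← localAt_units_smul, hlocO, hkO, hidx] at hlocJ
  -- compare exponents: `v_p(|N|) = v_p(n)`
  have hexp : (N.natAbs ^ 2).factorization p = (n ^ 2).factorization p :=
    Nat.pow_right_injective hp.out.two_le hlocJ
  rw [Nat.factorization_pow, Nat.factorization_pow] at hexp
  simp only [Finsupp.coe_smul, Pi.smul_apply, smul_eq_mul] at hexp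
  have hv : N.natAbs.factorization p = n.factorization p := by omega
  -- so `q = n / N` is `p`-integral
  have hq : ¬ p ∣ ((n : ℚ) / N).den := by
    refine not_dvd_den_of_padicValRat_nonneg (le_of_eq ?_)
    rw [padicValRat.div (by exact_mod_cast hn) hN0, padicValRat.of_nat, padicValRat.of_int,
      padicValInt, ← Nat.factorization_def _ hp.out, ← Nat.factorization_def _ hp.out, hv, sub_self]
  -- `z = β⁻¹ y ∈ O_(p)` and `δ̄ z ∈ O_(p)`
  have hz : ((β⁻¹ : Bˣ) : B) * y ∈ localAt p O := by
    rw [← mem_units_smul_iff_mul_mem, ← hJ]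
    exact le_localAt p J hy
  have hbar : standardInvolution ℚ B (δ : B) ∈ O := hO.toIsOrder.standardInvolution_mem hδ
  have hw : ((n : ℚ) / N) • (standardInvolution ℚ B (δ : B) * (((β⁻¹ : Bˣ) : B) * y)) ∈
      localAt p O :=
    rat_smul_mem_localAt (mul_mem_localAt hO.mul_mem p (le_localAt p O hbar) hz) hq
  -- `(β δ)⁻¹ (n y) = (n / N) δ̄ z`
  rw [hM, mem_units_smul_iff_mul_mem]
  convert hw using 1
  rw [mul_inv_rev, Units.val_mul, units_val_inv_eq_smul_standardInvolution, hN,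
    natCast_zsmul_eq_ratCast_smul, mul_assoc, smul_mul_assoc, mul_smul_comm, mul_smul_comm,
    smul_smul, div_eq_mul_inv, mul_comm (n : ℚ)]

/-- **Kaplansky in compatible form for a pair `M ⊆ J`.** For invertible right `O`-ideals
`M ⊆ J` of a `ℤ`-order `O` in a division quaternion algebra over `ℚ` and a prime `p` there are
units `β, δ` with `δ ∈ O`, `J_(p) = β O_(p)` and `M_(p) = β δ O_(p)` (Kaplansky's theorem for
`J` and for `M`, then clear the denominator of `β⁻¹ γ ∈ O_(p)` by an integer prime to `p`).
[cite: Voight2021, Main Thm. 16.6.1] -/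
theorem IsInvertibleRightIdeal.exists_localAt_eq_units_smul_pair
    (hdiv : ∀ x : B, x ≠ 0 → IsUnit x) {O M J : Submodule ℤ B} (hO : IsZOrder O)
    (hM : IsInvertibleRightIdeal O M) (hJ : IsInvertibleRightIdeal O J) (hle : M ≤ J)
    (p : ℕ) [hp : Fact p.Prime] :
    ∃ β δ : Bˣ, (δ : B) ∈ O ∧ localAt p J = β • localAt p O ∧
      localAt p M = (β * δ) • localAt p O := by
  obtain ⟨β, -, hβ⟩ := hJ.exists_localAt_eq_units_smul hdiv hO p
  obtain ⟨γ, hγM, hγ⟩ := hM.exists_localAt_eq_units_smul hdiv hO p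
  -- `β⁻¹ γ ∈ O_(p)`
  have hδ' : ((β⁻¹ : Bˣ) : B) * γ ∈ localAt p O := by
    rw [← mem_units_smul_iff_mul_mem, ← hβ]
    exact le_localAt p J (hle hγM)
  obtain ⟨m, hm0, hm, hmδ⟩ := hδ'
  have hmQ : (m : ℚ) ≠ 0 := by exact_mod_cast hm0
  -- the central unit `m · 1`
  let u : Bˣ := Units.map (algebraMap ℚ B : ℚ →+* B).toMonoidHom (Units.mk0 (m : ℚ) hmQ)
  have hu : (u : B) = algebraMap ℚ B m := rfl
  refine ⟨β, β⁻¹ * γ * u, ?_, hβ, ?_⟩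
  · -- `(β⁻¹ γ) · m = m • (β⁻¹ γ) ∈ O`
    rw [Units.val_mul, hu, ← Algebra.commutes, ← Algebra.smul_def, Units.val_mul,
      ← natCast_zsmul_eq_ratCast_smul]
    exact hmδ
  · rw [← mul_assoc, mul_inv_cancel_left, mul_smul, units_smul_localAt_of_val_eq hm0 hm _ hu, hγ]

/-- `n J ⊆ M` locally: for invertible right `O`-ideals `M ⊆ J` with `[J : M] = n²` in a
division quaternion algebra over `ℚ`, `n y ∈ M_(p)` for every `y ∈ J` and every prime `p`. [cite: Eichler1973, Ch. II §6 Thm. 2, (21)–(22)] -/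
theorem IsInvertibleRightIdeal.natCast_smul_mem_localAt (hdiv : ∀ x : B, x ≠ 0 → IsUnit x)
    {O M J : Submodule ℤ B} (hO : IsZOrder O) (hM : IsInvertibleRightIdeal O M)
    (hJ : IsInvertibleRightIdeal O J) (hle : M ≤ J) {n : ℕ}
    (hidx : M.toAddSubgroup.relIndex J.toAddSubgroup = n ^ 2) {y : B} (hy : y ∈ J)
    (p : ℕ) [Fact p.Prime] : (n : ℤ) • y ∈ localAt p M := by
  rcases eq_or_ne n 0 with rfl | hn
  · rw [Nat.cast_zero, zero_smul]; exact Submodule.zero_mem _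
  obtain ⟨β, δ, hδ, hβ, hβδ⟩ := hM.exists_localAt_eq_units_smul_pair hdiv hO hJ hle p
  exact natCast_smul_mem_localAt_of_localAt_eq hO hδ hβ hβδ hle hn hidx hy

/-- **Sub-ideals of index `n²` contain `n` times the ideal** (the arithmetic input of Eichler
1973, II §6 (21)–(22); equivalently: the integral ideal `J⁻¹ M` of reduced norm `n` divides
`n O`). For a `ℤ`-order `O` in a division quaternion algebra over `ℚ` and invertible right
`O`-ideals `M ⊆ J` with `[J : M] = n²`: `n J ⊆ M`. Local at each prime by Kaplansky's theorem
(`natCast_smul_mem_localAt`), global by `L = ⋂ₚ L_(p)`. [cite: Eichler1973, Ch. II §6 Thm. 2, (21)–(22)] -/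
theorem IsInvertibleRightIdeal.natCast_smul_mem_of_relIndex_eq_sq
    (hdiv : ∀ x : B, x ≠ 0 → IsUnit x) {O M J : Submodule ℤ B} (hO : IsZOrder O)
    (hM : IsInvertibleRightIdeal O M) (hJ : IsInvertibleRightIdeal O J) (hle : M ≤ J) {n : ℕ}
    (hidx : M.toAddSubgroup.relIndex J.toAddSubgroup = n ^ 2) {y : B} (hy : y ∈ J) :
    (n : ℤ) • y ∈ M :=
  mem_of_forall_prime_mem_localAt fun p hp =>
    haveI : Fact p.Prime := ⟨hp⟩
    hM.natCast_smul_mem_localAt hdiv hO hJ hle hidx hy p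

/-- Lattice form: `n • J ≤ M` for invertible right `O`-ideals `M ⊆ J` of index `n²`. [cite: Eichler1973, Ch. II §6 Thm. 2, (21)–(22)] -/
theorem IsInvertibleRightIdeal.natCast_smul_le_of_relIndex_eq_sq
    (hdiv : ∀ x : B, x ≠ 0 → IsUnit x) {O M J : Submodule ℤ B} (hO : IsZOrder O)
    (hM : IsInvertibleRightIdeal O M) (hJ : IsInvertibleRightIdeal O J) (hle : M ≤ J) {n : ℕ}
    (hidx : M.toAddSubgroup.relIndex J.toAddSubgroup = n ^ 2) :
    (n : ℤ) • J ≤ M := by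
  rintro x hx
  obtain ⟨y, hy, rfl⟩ := (Submodule.mem_smul_pointwise_iff_exists x (n : ℤ) J).mp hx
  exact hM.natCast_smul_mem_of_relIndex_eq_sq hdiv hO hJ hle hidx hy

/-- Translate form (the hypothesis shape of `BrandtWeightSymmetry.lean` /
`BrandtModuleWeightSymm.lean`): if `α I ⊆ J` has index `n²`, with `I, J` invertible right
`O`-ideals, then `n y ∈ α I` for all `y ∈ J`. [cite: Eichler1973, Ch. II §6 Thm. 2, (21)–(22)] -/
theorem IsInvertibleRightIdeal.natCast_smul_mem_units_smul
    (hdiv : ∀ x : B, x ≠ 0 → IsUnit x) {O I J : Submodule ℤ B} (hO : IsZOrder O)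
    (hI : IsInvertibleRightIdeal O I) (hJ : IsInvertibleRightIdeal O J) (α : Bˣ) {n : ℕ}
    (hle : α • I ≤ J) (hidx : (α • I).toAddSubgroup.relIndex J.toAddSubgroup = n ^ 2)
    {y : B} (hy : y ∈ J) : (n : ℤ) • y ∈ α • I :=
  (hI.units_smul α).natCast_smul_mem_of_relIndex_eq_sq hdiv hO hJ hle hidx hy

end Local

/-! ### The named fact `brandtMatrix_weight_symm` -/

section WeightSymm

/-- **Proof of the named fact `brandtMatrix_weight_symm` of `BrandtModule.lean`** (Eichler 1973,
II §6 Thm. 2 eq. (17)): for the Brandt data `(Cls O, w, B(·))` of every Eichler package,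
`w_j B(n)_ij = w_i B(n)_ji`. Assembly: the reduction `brandtMatrix_weight_symm_of_forall_nsmul_le`
(bijection `α ↦ n α⁻¹`, `2 w_i B(n)_ij = #A_ij(n)`) fed with the `n`-divisibility
`IsInvertibleRightIdeal.natCast_smul_mem_units_smul` (Kaplansky + local indices); the algebra of
a package is totally definite, hence a division algebra, and its `Brandt.rightIdeals` are the
invertible right ideals. [cite: Eichler1973, Ch. II §6 Thm. 2 eq. (17)] -/
theorem brandtMatrix_weight_symm_holds : brandtMatrix_weight_symm :=
  brandtMatrix_weight_symm_of_forall_nsmul_le fun _ _ P _ hI _ hJ α _ hle hidx _ hy =>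
    (isInvertibleRightIdeal_of_mem_rightIdeals hI).natCast_smul_mem_units_smul
      (fun _ hx => isUnit_of_isTotallyDefinite P.B P.isTotallyDefinite hx)
      P.isEichlerOrder.isZOrder (isInvertibleRightIdeal_of_mem_rightIdeals hJ) α hle hidx hy

/-- **The Hecke operators of the Brandt module are self-adjoint for the height pairing**:
`⟨t_n v, v'⟩ = ⟨v, t_n v'⟩` for the Brandt data of every Eichler package (Gross 1987 §1;
Pollack–Weston 2011 §2.1, "`𝕋` is adjoint"), now unconditional. [cite: PollackWeston2011, §2.1] -/
theorem EichlerPackage.pairing_hecke_comm {Nplus Nminus : ℕ} (P : EichlerPackage Nplus Nminus)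
    (n : ℕ) (v v' : P.brandtData.ι → ℤ) :
    P.brandtData.pairing (P.brandtData.hecke n v) v' =
      P.brandtData.pairing v (P.brandtData.hecke n v') :=
  brandtMatrix_weight_symm.pairing_hecke brandtMatrix_weight_symm_holds P n v v'

end WeightSymm

/-! ### The same symmetry in the vocabulary of `BrandtXi.lean` -/

namespace Brandt

variable {D : Type u} [Ring D] [Algebra ℚ D] [IsQuaternionAlgebra ℚ D]

/-- **Weight symmetry of the Brandt matrices of `BrandtXi.lean`**, `w_i T(n)_ij = w_j T(n)_ji`,
for every `ℤ`-order `O` of a division quaternion algebra over `ℚ` (in particular a totally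
definite one): `Brandt.weight_mul_matrix_symm_of_nsmul_le` with its `n`-divisibility hypotheses
discharged by `IsInvertibleRightIdeal.natCast_smul_mem_units_smul`. (`Brandt.matrix` is the
transpose of Eichler's `B(n)`, whence the placement of the weights.) [cite: Eichler1973, Ch. II §6 Thm. 2 eq. (17)] -/
theorem weight_mul_matrix_symm (hdiv : ∀ x : D, x ≠ 0 → IsUnit x) {O : Submodule ℤ D}
    (hO : IsOrder D O) (n : ℕ) (i j : ClassSet O) :
    (weight O i : ℤ) * matrix O n i j = (weight O j : ℤ) * matrix O n j i :=
  have hO' : IsZOrder O := isZOrder_iff_isOrder.mpr hO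
  weight_mul_matrix_symm_of_nsmul_le O n i j
    (fun α hle hidx _ hy => (isInvertibleRightIdeal_of_mem_rightIdeals i.rep_mem)
      |>.natCast_smul_mem_units_smul hdiv hO' (isInvertibleRightIdeal_of_mem_rightIdeals j.rep_mem)
        α hle hidx hy)
    (fun β hle hidx _ hy => (isInvertibleRightIdeal_of_mem_rightIdeals j.rep_mem)
      |>.natCast_smul_mem_units_smul hdiv hO' (isInvertibleRightIdeal_of_mem_rightIdeals i.rep_mem)
        β hle hidx hy)

/-- **Weight symmetry for every Brandt setup of type `(N⁺, N⁻)`** — the Brandt matrices entering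
Pollack–Weston's `ξ_f(N⁺, N⁻)` (`Brandt.XiSetup.xi`, `brandtXi`) are self-adjoint for
`⟨e_i, e_j⟩ = w_i δ_ij`: `w_i T(n)_ij = w_j T(n)_ji`. [cite: PollackWeston2011, §2.1] -/
theorem XiSetup.weight_mul_matrix_symm {Nplus Nminus : ℕ} (S : XiSetup Nplus Nminus) (n : ℕ)
    (i j : ClassSet S.O) :
    (weight S.O i : ℤ) * matrix S.O n i j = (weight S.O j : ℤ) * matrix S.O n j i :=
  Brandt.weight_mul_matrix_symm (fun _ hx => isUnit_of_isTotallyDefinite S.D S.isTotallyDefinite hx)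
    S.isEichlerOrder.isOrder n i j

end Brandt

end Literature.NumberTheory.Automorphic

end
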